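import Summits.RiemannHypothesis.RiemannHypothesis.Theses.LiAsymptotic
import Summits.RiemannHypothesis.RiemannHypothesis.Theorems.LiAsymptoticBoxTwoSidedPair
import HarnessLib

/-!
# RiemannHypothesis / LiAsymptotic — item `LiBoxTwoSided` (crux K1), part 2 (RH-FREE given the verified height):
# the two-sided box split of the Bombieri–Lagarias zero sum

Route `RiemannHypothesis/LiAsymptotic`, item `LiBoxTwoSided` (stmt-RiemannHypothesis-19163): `liBoxTwoSided_proof`.
RH-FREE [rh-li-prover].  Crux K1 of the rung L-P(P1⁺) «Li asymptotic law, quadratic range» (route dossier `LiAsymptotic`,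
cell `pub/rh-li`, theory memo `theory/TARGETS.md` §11.2 STEP 2).  For RH verified to height `T ≥ 4`, `T ≤ T'` and
`n ≤ T²/4`:

  `|Re ∑_{ρ ∈ liZeroBox T'} m(ρ)(1 − (1 − 1/ρ)ⁿ) − 2 ∑_{0 < Im ρ ≤ T'} m(ρ) f_n(Im ρ)|
      ≤ 2.82 n² ∑_{T < Im ρ ≤ T'} m/(Im ρ)⁴ + (n/2) ∑_{T < Im ρ ≤ T'} m/(Im ρ)³`

(`liBoxTwoSided_bound`; the two-sided upgrade of the tree's `BoxSplit.re_boxSum_ge` of route `LiCoefficients`):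
* `re_boxSum_eq` (RH-free bookkeeping, an IDENTITY): conjugation doubles the upper half-plane and `ρ ↦ 1 − ρ̄` is a
  multiplicity-preserving involution of `zerosBetween T T'`, so
  `Re ∑_{box T'} = 2 ∑_{0 < Im ρ ≤ T} m Re(1 − wⁿ) + ∑_{T < Im ρ ≤ T'} m [Re(1 − wⁿ) + Re(1 − w'ⁿ)]`;
* below `T` the zeros are on the line and `Re(1 − wⁿ) = f_n(γ)` exactly (tree `re_one_sub_pow_onLine`);
* above `T` the pair lemma `pair_two_sided` (part 1, `LiAsymptoticBoxTwoSidedPair.lean`) bounds each term.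

Nothing here bears on the truth of RH: the only hypothesis is the FINITE verified height `RiemannHypothesisUpTo T`.
-/

noncomputable section

-- D-0017: `Summit.<S>.<S>.…` is the designed namespace of a single-problem summit.
set_option linter.dupNamespace false

open Complex Filter Set
open scoped Real ComplexConjugate Topology

namespace Summit.RiemannHypothesis.RiemannHypothesis.Theorems.LiTheory

open Literature.NumberTheory.LFunctions Literature.NumberTheory.LFunctions.SchoenfeldBound
open Literature.NumberTheory.DiophantineGeometry

namespace BoxSplit

/-! ### The box bookkeeping (an identity) -/

/-- Splitting a window sum at an intermediate height: `∑_{0<γ≤b} = ∑_{0<γ≤a} + ∑_{a<γ≤b}` (`0 ≤ a ≤ b`). -/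
theorem sum_zerosBetween_split_at {a b : ℝ} (ha : 0 ≤ a) (hab : a ≤ b) (g : ℂ → ℝ) :
    ∑ ρ ∈ zerosBetween 0 b, g ρ = (∑ ρ ∈ zerosBetween 0 a, g ρ) + ∑ ρ ∈ zerosBetween a b, g ρ := by
  classical
  have hsub : zerosBetween 0 a ⊆ zerosBetween 0 b := by
    intro ρ hρ
    rw [mem_zerosBetween le_rfl] at hρ ⊢
    exact ⟨hρ.1, hρ.2.1, hρ.2.2.1, hρ.2.2.2.1, hρ.2.2.2.2.trans hab⟩
  have hsd : zerosBetween a b = zerosBetween 0 b \ zerosBetween 0 a := by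
    ext ρ
    rw [Finset.mem_sdiff, mem_zerosBetween ha, mem_zerosBetween le_rfl, mem_zerosBetween le_rfl]
    constructor
    · rintro ⟨h0, h1, h2, h3, h4⟩
      exact ⟨⟨h0, h1, h2, by linarith, h4⟩, fun h ↦ by linarith [h.2.2.2.2]⟩
    · rintro ⟨⟨h0, h1, h2, h3, h4⟩, hn⟩
      refine ⟨h0, h1, h2, ?_, h4⟩
      by_contra hle
      exact hn ⟨h0, h1, h2, h3, not_lt.1 hle⟩
  rw [hsd, ← Finset.sum_sdiff hsub, add_comm]

/-- **K1b (RH-free box bookkeeping).**  For `0 ≤ T ≤ T'`: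
`Re ∑_{ρ ∈ liZeroBox T'} m(ρ)(1 − (1 − 1/ρ)ⁿ) = 2 ∑_{0 < Im ρ ≤ T} m Re(1 − wⁿ) + ∑_{T < Im ρ ≤ T'} m [Re(1 − wⁿ) + Re(1 − w'ⁿ)]`,
`w = 1 − 1/ρ`, `w' = 1 − 1/(1 − ρ̄)` (conjugation doubles the upper half-plane; `ρ ↦ 1 − ρ̄` is a
multiplicity-preserving involution of `zerosBetween T T'`). -/
theorem re_boxSum_eq (n : ℕ) {T T' : ℝ} (hT0 : 0 ≤ T) (hTT' : T ≤ T') :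
    (∑ᶠ ρ ∈ liZeroBox T', (riemannZetaZeroOrder ρ : ℂ) * (1 - (1 - 1 / ρ) ^ n)).re =
      2 * ∑ ρ ∈ zerosBetween 0 T, (riemannZetaZeroOrder ρ : ℝ) * (1 - (1 - 1 / ρ) ^ n).re +
        ∑ ρ ∈ zerosBetween T T', (riemannZetaZeroOrder ρ : ℝ) *
          ((1 - (1 - 1 / ρ) ^ n).re + (1 - (1 - 1 / (1 - conj ρ)) ^ n).re) := by
  classical
  rw [finsum_mem_eq_finite_toFinset_sum _ (liZeroBox_finite T'), Complex.re_sum]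
  set B := (liZeroBox_finite T').toFinset with hB
  have hmem : ∀ ρ, ρ ∈ B ↔ ρ ∈ liZeroBox T' := fun ρ ↦ Set.Finite.mem_toFinset _
  set f : ℂ → ℝ := fun ρ ↦ (riemannZetaZeroOrder ρ : ℝ) * (1 - (1 - 1 / ρ) ^ n).re with hf
  have hfval : ∀ ρ : ℂ, ((riemannZetaZeroOrder ρ : ℂ) * (1 - (1 - 1 / ρ) ^ n)).re = f ρ := by
    intro ρ
    simp only [hf, Complex.mul_re, Complex.intCast_re, Complex.intCast_im, zero_mul, sub_zero]
  rw [Finset.sum_congr rfl fun ρ _ ↦ hfval ρ]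
  -- `f` is conjugation invariant
  have hfconj : ∀ ρ : ℂ, f (conj ρ) = f ρ := by
    intro ρ
    simp only [hf]
    rw [riemannZetaZeroOrder_conj_holds ρ]
    congr 1
    have : (1 : ℂ) - (1 - 1 / conj ρ) ^ n = conj (1 - (1 - 1 / ρ) ^ n) := by
      simp [map_sub, map_pow]
    rw [this, Complex.conj_re]
  -- split `B` into the upper and the lower half-plane
  set Bup := B.filter (fun ρ ↦ 0 < ρ.im) with hBup
  set Bdn := B.filter (fun ρ ↦ ¬ 0 < ρ.im) with hBdn
  have hsplit : ∑ ρ ∈ B, f ρ = ∑ ρ ∈ Bup, f ρ + ∑ ρ ∈ Bdn, f ρ :=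
    (Finset.sum_filter_add_sum_filter_not B _ _).symm
  have hup : Bup = zerosBetween 0 T' := by
    ext ρ
    rw [hBup, Finset.mem_filter, hmem, mem_zerosBetween le_rfl]
    constructor
    · rintro ⟨⟨hz, h0, h1, -, h4⟩, hpos⟩
      exact ⟨hz, h0, h1, hpos, by rwa [abs_of_pos hpos] at h4⟩
    · rintro ⟨hz, h0, h1, h3, h4⟩
      exact ⟨⟨hz, h0, h1, by rwa [abs_of_pos h3], by rwa [abs_of_pos h3]⟩, h3⟩
  have hdn : Bdn = (zerosBetween 0 T').image conj := by
    ext ρ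
    rw [hBdn, Finset.mem_filter, hmem, Finset.mem_image]
    constructor
    · rintro ⟨⟨hz, h0, h1, h3, h4⟩, hnpos⟩
      have hneg : ρ.im < 0 := by
        rcases lt_trichotomy ρ.im 0 with h | h | h
        · exact h
        · exfalso; rw [h, abs_zero] at h3; exact lt_irrefl _ h3
        · exact absurd h hnpos
      refine ⟨conj ρ, (mem_zerosBetween le_rfl).2 ⟨by rw [riemannZeta_conj, hz, map_zero], by simpa using h0,
        by simpa using h1, ?_, ?_⟩, by simp⟩
      · rw [Complex.conj_im]; linarith
      · rw [Complex.conj_im]; rw [abs_of_neg hneg] at h4; exact h4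
    · rintro ⟨ρ₀, hρ₀, rfl⟩
      obtain ⟨hz, h0, h1, h3, h4⟩ := (mem_zerosBetween le_rfl).1 hρ₀
      refine ⟨⟨by rw [riemannZeta_conj, hz, map_zero], by simpa using h0, by simpa using h1, ?_, ?_⟩, ?_⟩
      · rw [Complex.conj_im, abs_neg, abs_of_pos h3]; exact h3
      · rw [Complex.conj_im, abs_neg, abs_of_pos h3]; exact h4
      · rw [Complex.conj_im]; linarith
  have hconj_inj : Set.InjOn (conj : ℂ → ℂ) (zerosBetween 0 T') := fun x _ y _ h ↦ by
    simpa using congrArg conj h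
  have hdn_sum : ∑ ρ ∈ Bdn, f ρ = ∑ ρ ∈ zerosBetween 0 T', f ρ := by
    rw [hdn, Finset.sum_image hconj_inj]
    exact Finset.sum_congr rfl fun ρ _ ↦ hfconj ρ
  rw [hsplit, hup, hdn_sum, ← two_mul, sum_zerosBetween_split_at hT0 hTT' f]
  -- the reflection on `zerosBetween T T'`
  have hσmem : ∀ ρ ∈ zerosBetween T T', 1 - conj ρ ∈ zerosBetween T T' := by
    intro ρ hρ
    obtain ⟨hz, h0, h1, h3, h4⟩ := (mem_zerosBetween hT0).1 hρ
    have him0 : ρ.im ≠ 0 := by linarith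
    have hρ1 : ρ ≠ 1 := fun h ↦ him0 (by simp [h])
    have hre_pos : 0 < ρ.re := re_pos_of_riemannZeta_eq_zero hz him0
    have hre_lt : ρ.re < 1 :=
      lt_of_le_of_ne h1 fun h ↦ riemannZeta_ne_zero_of_one_le_re (le_of_eq h.symm) hz
    have h1' : (1 : ℂ) - conj ρ ≠ 1 := by
      intro h; apply him0; have h' := congrArg Complex.im h; simpa using h'
    have hm : 0 < riemannZetaZeroOrder (1 - conj ρ) := by
      rw [riemannZetaZeroOrder_one_sub_conj hre_pos hre_lt]
      exact (riemannZetaZeroOrder_pos_iff hρ1).2 hz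
    refine (mem_zerosBetween hT0).2 ⟨(riemannZetaZeroOrder_pos_iff h1').1 hm, ?_, ?_, ?_, ?_⟩
    · simp only [sub_re, one_re, conj_re]; linarith
    · simp only [sub_re, one_re, conj_re]; linarith
    · simpa using h3
    · simpa using h4
  have hσσ : ∀ ρ : ℂ, 1 - conj (1 - conj ρ) = ρ := fun ρ ↦ by simp
  have hreindex : ∑ ρ ∈ zerosBetween T T', f (1 - conj ρ) = ∑ ρ ∈ zerosBetween T T', f ρ :=
    Finset.sum_nbij' (fun ρ ↦ 1 - conj ρ) (fun ρ ↦ 1 - conj ρ) hσmem hσmem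
      (fun ρ _ ↦ hσσ ρ) (fun ρ _ ↦ hσσ ρ) fun _ _ ↦ rfl
  have hmσ : ∀ ρ ∈ zerosBetween T T', riemannZetaZeroOrder (1 - conj ρ) = riemannZetaZeroOrder ρ := by
    intro ρ hρ
    obtain ⟨hz, -, h1, h3, -⟩ := (mem_zerosBetween hT0).1 hρ
    have him0 : ρ.im ≠ 0 := by linarith
    have hre_pos : 0 < ρ.re := re_pos_of_riemannZeta_eq_zero hz him0
    have hre_lt : ρ.re < 1 :=
      lt_of_le_of_ne h1 fun h ↦ riemannZeta_ne_zero_of_one_le_re (le_of_eq h.symm) hz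
    exact riemannZetaZeroOrder_one_sub_conj hre_pos hre_lt
  have hpair : ∑ ρ ∈ zerosBetween T T', (riemannZetaZeroOrder ρ : ℝ) *
      ((1 - (1 - 1 / ρ) ^ n).re + (1 - (1 - 1 / (1 - conj ρ)) ^ n).re) =
      ∑ ρ ∈ zerosBetween T T', (f ρ + f (1 - conj ρ)) := by
    refine Finset.sum_congr rfl fun ρ hρ ↦ ?_
    simp only [hf, hmσ ρ hρ]
    ring
  rw [hpair, Finset.sum_add_distrib, hreindex]
  ring

end BoxSplit

open BoxSplit

/-- **Crux `LiBoxTwoSided` (K1; RH-free apart from the verified height).**  For RH verified to `T`, `4 ≤ T ≤ T'`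
and `n ≤ T²/4`:
`|Re ∑_{ρ ∈ liZeroBox T'} m(ρ)(1 − (1 − 1/ρ)ⁿ) − 2 ∑_{0 < Im ρ ≤ T'} m(ρ) f_n(Im ρ)|
  ≤ 2.82 n² ∑_{T < Im ρ ≤ T'} m/(Im ρ)⁴ + (n/2) ∑_{T < Im ρ ≤ T'} m/(Im ρ)³`
(`re_boxSum_eq` + on-line exactness `re_one_sub_pow_onLine` below `T` + `pair_two_sided` termwise above `T`). -/
theorem liBoxTwoSided_bound :
    ∀ (n : ℕ) (T T' : ℝ), Literature.NumberTheory.DiophantineGeometry.RiemannHypothesisUpTo T → 4 ≤ T → T ≤ T' →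
      (n : ℝ) ≤ T ^ 2 / 4 →
      |(∑ᶠ ρ ∈ Literature.NumberTheory.LFunctions.liZeroBox T',
            (Literature.NumberTheory.LFunctions.riemannZetaZeroOrder ρ : ℂ) * (1 - (1 - 1 / ρ) ^ n)).re
          - 2 * ∑ ρ ∈ Literature.NumberTheory.LFunctions.SchoenfeldBound.zerosBetween 0 T',
              (Literature.NumberTheory.LFunctions.riemannZetaZeroOrder ρ : ℝ) *
                Summit.RiemannHypothesis.RiemannHypothesis.Theorems.LiTheory.liWindowWeight n ρ.im|
        ≤ 2.82 * (n : ℝ) ^ 2 *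
            (∑ ρ ∈ Literature.NumberTheory.LFunctions.SchoenfeldBound.zerosBetween T T',
              (Literature.NumberTheory.LFunctions.riemannZetaZeroOrder ρ : ℝ) / ρ.im ^ 4)
          + (n : ℝ) / 2 *
            (∑ ρ ∈ Literature.NumberTheory.LFunctions.SchoenfeldBound.zerosBetween T T',
              (Literature.NumberTheory.LFunctions.riemannZetaZeroOrder ρ : ℝ) / ρ.im ^ 3) := by
  intro n T T' hRH hT4 hTT' hn4
  have hT0 : (0 : ℝ) ≤ T := by linarith
  rw [re_boxSum_eq n hT0 hTT']
  -- on-line terms below T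
  have hcongr : ∑ ρ ∈ zerosBetween 0 T, (riemannZetaZeroOrder ρ : ℝ) * (1 - (1 - 1 / ρ) ^ n).re =
      ∑ ρ ∈ zerosBetween 0 T, (riemannZetaZeroOrder ρ : ℝ) * liWindowWeight n ρ.im := by
    refine Finset.sum_congr rfl fun ρ hρ ↦ ?_
    obtain ⟨hz, -, -, h3, h4⟩ := (mem_zerosBetween le_rfl).1 hρ
    rw [re_one_sub_pow_onLine n (hRH ρ hz h3 h4) (ne_of_gt h3)]
  rw [hcongr, sum_zerosBetween_split_at hT0 hTT' (fun ρ ↦ (riemannZetaZeroOrder ρ : ℝ) * liWindowWeight n ρ.im)]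
  -- the difference is the sum of the pair errors above T
  have hdiff : 2 * (∑ ρ ∈ zerosBetween 0 T, (riemannZetaZeroOrder ρ : ℝ) * liWindowWeight n ρ.im) +
        (∑ ρ ∈ zerosBetween T T', (riemannZetaZeroOrder ρ : ℝ) *
          ((1 - (1 - 1 / ρ) ^ n).re + (1 - (1 - 1 / (1 - conj ρ)) ^ n).re)) -
        2 * ((∑ ρ ∈ zerosBetween 0 T, (riemannZetaZeroOrder ρ : ℝ) * liWindowWeight n ρ.im) +
          ∑ ρ ∈ zerosBetween T T', (riemannZetaZeroOrder ρ : ℝ) * liWindowWeight n ρ.im) =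
      ∑ ρ ∈ zerosBetween T T', (riemannZetaZeroOrder ρ : ℝ) *
        ((1 - (1 - 1 / ρ) ^ n).re + (1 - (1 - 1 / (1 - conj ρ)) ^ n).re - 2 * liWindowWeight n ρ.im) := by
    rw [show ∑ ρ ∈ zerosBetween T T', (riemannZetaZeroOrder ρ : ℝ) *
        ((1 - (1 - 1 / ρ) ^ n).re + (1 - (1 - 1 / (1 - conj ρ)) ^ n).re - 2 * liWindowWeight n ρ.im) =
        ∑ ρ ∈ zerosBetween T T', ((riemannZetaZeroOrder ρ : ℝ) *
          ((1 - (1 - 1 / ρ) ^ n).re + (1 - (1 - 1 / (1 - conj ρ)) ^ n).re) -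
          2 * ((riemannZetaZeroOrder ρ : ℝ) * liWindowWeight n ρ.im)) from
        Finset.sum_congr rfl fun ρ _ ↦ by ring,
      Finset.sum_sub_distrib, ← Finset.mul_sum]
    ring
  rw [hdiff]
  -- termwise bound
  have hkey : ∀ ρ ∈ zerosBetween T T',
      |(riemannZetaZeroOrder ρ : ℝ) *
        ((1 - (1 - 1 / ρ) ^ n).re + (1 - (1 - 1 / (1 - conj ρ)) ^ n).re - 2 * liWindowWeight n ρ.im)| ≤
        2.82 * (n : ℝ) ^ 2 * ((riemannZetaZeroOrder ρ : ℝ) / ρ.im ^ 4) +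
          (n : ℝ) / 2 * ((riemannZetaZeroOrder ρ : ℝ) / ρ.im ^ 3) := by
    intro ρ hρ
    obtain ⟨-, h0, h1', h3, -⟩ := (mem_zerosBetween hT0).1 hρ
    have hγ4 : 4 ≤ ρ.im := by linarith
    have hγpos : 0 < ρ.im := by linarith
    have hγ2 : T ^ 2 ≤ ρ.im ^ 2 := by nlinarith
    have hn' : (n : ℝ) ≤ ρ.im ^ 2 / 4 := by linarith
    have hp := pair_two_sided n h0 h1' hγ4 hn'
    have hρ1 : ρ ≠ 1 := fun h ↦ by rw [h, Complex.one_im] at hγpos; exact lt_irrefl _ hγpos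
    have hm : (0 : ℝ) ≤ (riemannZetaZeroOrder ρ : ℝ) := by
      exact_mod_cast riemannZetaZeroOrder_nonneg hρ1
    rw [abs_mul, abs_of_nonneg hm]
    have := mul_le_mul_of_nonneg_left hp hm
    have hrew : (riemannZetaZeroOrder ρ : ℝ) * (2.82 * (n : ℝ) ^ 2 / ρ.im ^ 4 + (n : ℝ) / (2 * ρ.im ^ 3)) =
        2.82 * (n : ℝ) ^ 2 * ((riemannZetaZeroOrder ρ : ℝ) / ρ.im ^ 4) +
          (n : ℝ) / 2 * ((riemannZetaZeroOrder ρ : ℝ) / ρ.im ^ 3) := by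
      field_simp
    linarith [hrew]
  refine (Finset.abs_sum_le_sum_abs _ _).trans ?_
  refine (Finset.sum_le_sum hkey).trans (le_of_eq ?_)
  simp only [Finset.sum_add_distrib, Finset.mul_sum]

/-- **Item `LiBoxTwoSided` of route `LiAsymptotic` — PROVED** (FQ type, by name). -/
theorem liBoxTwoSided_proof :
    Summit.RiemannHypothesis.RiemannHypothesis.Theses.LiAsymptotic.LiBoxTwoSided :=
  liBoxTwoSided_bound

end Summit.RiemannHypothesis.RiemannHypothesis.Theorems.LiTheory

end
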